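import Literature.Computability.Cryptography.IndistinguishabilityAppend
import Literature.Computability.Cryptography.IndistinguishabilityPostProcessing
import HarnessLib

/-!
# Indistinguishability is preserved by post-processing with polynomially bounded advice (HILL 1999, Def. 3.1.1)

Håstad–Impagliazzo–Levin–Luby 1999 allow, in the mildly non-uniform setting, adversaries that receive the
advice of the primitive they attack:

> **Definition (mildly non-uniform adversary), §3.1 / Def. 2.3.3**: "… it has an additional input `aₙ` called
> the advice, that is an integer-valued polynomial parameter that is not necessarily **P**-time computable."

In the tree's model of probabilistic machines (`RandAlg`: the coin budget `coinLen` of a machine is an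
ARBITRARY polynomially bounded function of the input length — `Indistinguishability.lean`), a polynomially
bounded integer advice `a*(n) ≤ q(n)` can be handed to a uniform program through its coin budget, exactly as
the coin count of a simulated distinguisher is in `IndistinguishabilityPostProcessing.lean` /
`MildlyNonuniformPRG.lean` (`AdvStretch.red`: "three numbers packed"). This file proves the corresponding
closure property, the advice version of `IsCompIndistinguishable.map_fp`:

* `AdvPost.red D F q cl` — "decode `⟨1^κ, 1^a⟩ = divMod(|coins|, q(n)+1)`, apply `F` to `⟨1ⁿ, ⟨1^a, s⟩⟩`,
  run `D` on the result with the first `κ` coins"; `isPPT_red`, `outputPMF_red`, `acceptPMF_red`;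
* **`IsCompIndistinguishable.map_fp_advice`** — if `X ≈_c Y` (level-wise length `ℓ(n)`, polynomially
  bounded), `F ∈ FP`, and `a*(n) ≤ q(n)`, then `n ↦ F⟨1ⁿ, ⟨1^{a*(n)}, X_n⟩⟩ ≈_c n ↦ F⟨1ⁿ, ⟨1^{a*(n)}, Y_n⟩⟩`.

No new named facts.
-/

namespace Literature.Computability.Cryptography

open Filter Asymptotics Polynomial _root_.Computability Complexity Complexity.Brick Complexity.Plumb MetaComplexity
  PRGTrunc PRGPrefix PostProc

namespace AdvPost

variable (F : List Bool → List Bool) (q : Polynomial ℕ)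

/-- `|1ⁿ| = n`. [folklore] -/
private theorem length_unary (n : ℕ) : (unaryEncodeNat n).length = n := unary_decode_encode_nat n

/-- `⟨1^{|r| / B}, 1^{|r| mod B}⟩` with `B = q(|u|) + 1`, on `⟨⟨u, s⟩, r⟩`. [folklore] -/
noncomputable def dmF : List Bool → List Bool :=
  divModFn ∘ fanoutFn (polyFn (q + 1) ∘ fstF ∘ fstF) (onesFn ∘ sndF)

/-- **The preprocessing** `⟨⟨u, s⟩, r⟩ ↦ ⟨⟨u, F⟨u, ⟨1^a, s⟩⟩⟩, r ↾ κ⟩`. [folklore] -/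
noncomputable def coreF : List Bool → List Bool :=
  fanoutFn (fanoutFn (fstF ∘ fstF) (F ∘ fanoutFn (fstF ∘ fstF) (fanoutFn (sndF ∘ dmF q) (sndF ∘ fstF))))
    (takeFn ∘ fanoutFn (fstF ∘ dmF q) sndF)

/-- `dmF`, `coreF ∈ FP` for `F ∈ FP`. [cite: AroraBarak2009, §1.3] -/
theorem coreF_mem_FP (hF : F ∈ FP) : coreF F q ∈ FP := by
  have hdm : dmF q ∈ FP := comp_mem_FP divModFn_mem_FP (fanoutFn_mem_FP
    (comp_mem_FP (polyFn_mem_FP _) (comp_mem_FP fstF_mem_FP fstF_mem_FP)) (comp_mem_FP onesFn_mem_FP sndF_mem_FP))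
  exact fanoutFn_mem_FP (fanoutFn_mem_FP (comp_mem_FP fstF_mem_FP fstF_mem_FP)
    (comp_mem_FP hF (fanoutFn_mem_FP (comp_mem_FP fstF_mem_FP fstF_mem_FP) (fanoutFn_mem_FP (comp_mem_FP sndF_mem_FP hdm)
      (comp_mem_FP sndF_mem_FP fstF_mem_FP))))) (comp_mem_FP takeFn_mem_FP (fanoutFn_mem_FP (comp_mem_FP fstF_mem_FP hdm) sndF_mem_FP))

/-- Value of `dmF`. [folklore] -/
theorem dmF_apply (u s r : List Bool) :
    dmF q (boolPair (boolPair u s) r) = boolPair (ones (r.length / (q.eval u.length + 1))) (ones (r.length % (q.eval u.length + 1))) := by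
  simp only [dmF, Function.comp_apply, fanoutFn_apply, fstF_boolPair, sndF_boolPair, polyFn_apply, onesFn, unaryEncodeNat_eq_replicate,
    eval_add, eval_one]
  exact divModFn_boolPair _ _

/-- **Value of the preprocessing.** [folklore] -/
theorem coreF_apply (u s r : List Bool) :
    coreF F q (boolPair (boolPair u s) r) =
      boolPair (boolPair u (F (boolPair u (boolPair (ones (r.length % (q.eval u.length + 1))) s))))
        (r.take (r.length / (q.eval u.length + 1))) := by
  simp only [coreF, Function.comp_apply, fanoutFn_apply, fstF_boolPair, sndF_boolPair, dmF_apply, takeFn_boolPair, ones,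
    List.length_replicate]

/-- **The reduction**: run `D` on `⟨1ⁿ, F⟨1ⁿ, ⟨1^a, s⟩⟩⟩`, the advice `a` and `D`'s coin count being read off
the coin budget `cl`. [cite: HastadImpagliazzoLevinLuby1999, Def. 2.3.3 / §3.1 (mildly non-uniform adversary)] -/
noncomputable def red (D : RandAlg (List Bool) Bool) (cl : ℕ → ℕ) : RandAlg (List Bool) Bool where
  run x r := D.run (fstF (coreF F q (boolPair x r))) (sndF (coreF F q (boolPair x r)))
  coinLen := cl

/-- **`red` is PPT** for PPT `D`, `F ∈ FP`, polynomially bounded budget. [cite: AroraBarak2009, §1.3] -/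
theorem isPPT_red {D : RandAlg (List Bool) Bool} (hD : IsPPT D encodeBool) (hF : F ∈ FP) {cl : ℕ → ℕ}
    (hcl : ∃ p : Polynomial ℕ, ∀ n, cl n ≤ p.eval n) : IsPPT (red F q D cl) encodeBool := by
  refine ⟨?_, hcl⟩
  exact PolyTimeComputable.of_encode_eq (f := (fun w => encodeBool (D.run (fstF w) (sndF w))) ∘ coreF F q)
    (fun p : List Bool × List Bool => boolPair p.1 p.2) (fun _ => rfl) (fun _ => rfl)
    (comp_mem_FP (Hybrid.distFn_mem_FP hD) (coreF_mem_FP F q hF))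

/-- A prefix of a uniform string is uniform: `E_{r ← U_{κ+c}} G(r ↾ κ) = E_{r' ← U_κ} G(r')`. [folklore] -/
theorem uniformAvg_take_prefix (κ c : ℕ) (G : List Bool → ℝ) : uniformAvg (κ + c) (fun r => G (r.take κ)) = uniformAvg κ G := by
  rw [uniformAvg_append]
  refine uniformAvg_congr fun u hu => ?_
  rw [uniformAvg_congr fun w _ => by rw [List.take_append_of_le_length hu.ge, List.take_of_length_le hu.le], uniformAvg_const]

/-- **Output law of the reduction** on `⟨1ⁿ, s⟩` when the budget there is `κ·(q(n)+1) + a` with `a ≤ q(n)` and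
`κ` the coin count of `D` on the post-processed input: the law of `D` on `⟨1ⁿ, F⟨1ⁿ, ⟨1^a, s⟩⟩⟩`.
[cite: HastadImpagliazzoLevinLuby1999, §3.1 (mildly non-uniform adversary)] -/
theorem outputPMF_red (D : RandAlg (List Bool) Bool) {cl : ℕ → ℕ} {n a : ℕ} {s : List Bool} (ha : a ≤ q.eval n)
    (hcl : cl (2 * n + 2 + s.length) =
      D.coinLen (boolPair (unaryEncodeNat n) (F (boolPair (unaryEncodeNat n) (boolPair (ones a) s)))).length * (q.eval n + 1) + a) :
    (red F q D cl).outputPMF id (boolPair (unaryEncodeNat n) s) =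
      D.outputPMF id (boolPair (unaryEncodeNat n) (F (boolPair (unaryEncodeNat n) (boolPair (ones a) s)))) := by
  classical
  set u := unaryEncodeNat n with hu
  set x' := boolPair u (F (boolPair u (boolPair (ones a) s))) with hx'
  set κ := D.coinLen x'.length with hκ
  have hun : u.length = n := length_unary n
  have hB : 0 < q.eval n + 1 := Nat.succ_pos _
  have hdiv : (κ * (q.eval n + 1) + a) / (q.eval n + 1) = κ := by
    rw [Nat.add_comm, Nat.add_mul_div_right _ _ hB, Nat.div_eq_of_lt (Nat.lt_succ_of_le ha), zero_add]
  have hmod : (κ * (q.eval n + 1) + a) % (q.eval n + 1) = a := by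
    rw [Nat.add_comm, Nat.add_mul_mod_self_right, Nat.mod_eq_of_lt (Nat.lt_succ_of_le ha)]
  refine AppendSamp.pmf_bool_eq_of_toReal_true_eq ?_
  have hlenA : (red F q D cl).coinLen (id (boolPair u s)).length = κ + (κ * q.eval n + a) := by
    show cl (boolPair u s).length = _
    rw [length_boolPair, hun, hcl]; ring
  have hL : ((red F q D cl).outputPMF id (boolPair u s) true).toReal =
      uniformAvg (κ + (κ * q.eval n + a)) fun r => if D.run x' (r.take κ) = true then (1 : ℝ) else 0 := by
    rw [show ((red F q D cl).outputPMF id (boolPair u s) true).toReal = (red F q D cl).pr id (boolPair u s) {true} by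
        rw [RandAlg.pr, PMF.toOuterMeasure_apply_singleton],
      RandAlg.pr_true_eq_uniformAvg _ id _ hlenA]
    refine uniformAvg_congr fun r hr => ?_
    have hr' : r.length = κ * (q.eval n + 1) + a := by rw [hr]; ring
    have hrun : (red F q D cl).run (boolPair u s) r = D.run x' (r.take κ) := by
      show D.run (fstF (coreF F q (boolPair (boolPair u s) r))) (sndF (coreF F q (boolPair (boolPair u s) r))) = _
      rw [coreF_apply, fstF_boolPair, sndF_boolPair, hun, hr', hdiv, hmod]
    rw [hrun]
  have hR : (D.outputPMF id x' true).toReal = uniformAvg κ fun r => if D.run x' r = true then (1 : ℝ) else 0 := by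
    rw [show (D.outputPMF id x' true).toReal = D.pr id x' {true} by rw [RandAlg.pr, PMF.toOuterMeasure_apply_singleton]]
    exact RandAlg.pr_true_eq_uniformAvg D id _ rfl
  rw [hL, hR]
  exact uniformAvg_take_prefix κ _ fun r => if D.run x' r = true then (1 : ℝ) else 0

/-- **Acceptance of the reduction on an ensemble of level-wise length `ℓ`.** [cite: Goldreich2001, Def. 3.2.2] -/
theorem acceptPMF_red (D : RandAlg (List Bool) Bool) {cl : ℕ → ℕ} {n a : ℕ} (X : PMF (List Bool)) {ℓ ℓ' : ℕ}
    (hX : ∀ s ∈ X.support, s.length = ℓ) (ha : a ≤ q.eval n)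
    (hF : ∀ s ∈ X.support, (F (boolPair (unaryEncodeNat n) (boolPair (ones a) s))).length = ℓ')
    (hcl : cl (2 * n + 2 + ℓ) = D.coinLen (2 * n + 2 + ℓ') * (q.eval n + 1) + a) :
    acceptPMF (red F q D cl) n X = acceptPMF D n (X.map fun s => F (boolPair (unaryEncodeNat n) (boolPair (ones a) s))) := by
  rw [acceptPMF, acceptPMF, PMF.bind_map]
  refine pmf_bind_congr_of_mem_support X fun s hs => ?_
  rw [Function.comp_apply]
  refine outputPMF_red F q D ha ?_
  rw [hX s hs, hcl, length_boolPair, length_unary, hF s hs]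

/-- **The advice budget**: at a length attained on `S`, `κ·(q(n)+1) + a*(n)` for the selected parameter. [folklore] -/
noncomputable def advCl (D : RandAlg (List Bool) Bool) (ℓ' aStar : ℕ → ℕ) (S : Set ℕ) (len : ℕ → ℕ) (L : ℕ) : ℕ :=
  open scoped Classical in
  if ∃ n, n ∈ S ∧ len n = L then
    D.coinLen (2 * nOf S len L + 2 + ℓ' (nOf S len L)) * (q.eval (nOf S len L) + 1) + aStar (nOf S len L) else 0

/-- On a good parameter the budget is the intended one. [folklore] -/
theorem advCl_len_of_mem_good (D : RandAlg (List Bool) Bool) (ℓ' aStar : ℕ → ℕ) {S : Set ℕ} {len : ℕ → ℕ} {n : ℕ}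
    (hn : n ∈ good S len) : advCl q D ℓ' aStar S len (len n) = D.coinLen (2 * n + 2 + ℓ' n) * (q.eval n + 1) + aStar n := by
  have hpre : ∃ m, m ∈ S ∧ len m = len n := ⟨n, hn.1, rfl⟩
  simp only [advCl, if_pos hpre, hn.2]

/-- The advice budget is polynomially bounded. [cite: AroraBarak2009, Def. 7.1] -/
theorem advCl_le (D : RandAlg (List Bool) Bool) {ℓ' aStar : ℕ → ℕ} (S : Set ℕ) {len : ℕ → ℕ} (hlen : ∀ m, m ≤ len m)
    {p P' : Polynomial ℕ} (hp : ∀ k, D.coinLen k ≤ p.eval k) (hP' : ∀ n, ℓ' n ≤ P'.eval n) (ha : ∀ n, aStar n ≤ q.eval n) (L : ℕ) :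
    advCl q D ℓ' aStar S len L ≤ (p.comp (2 * X + 2 + P') * (q + 1) + q).eval L := by
  by_cases hL : ∃ n, n ∈ S ∧ len n = L
  · simp only [advCl, if_pos hL]
    obtain ⟨-, hfix⟩ := nOf_spec hL
    have hnL : nOf S len L ≤ L := (hlen _).trans hfix.le
    have h1 : D.coinLen (2 * nOf S len L + 2 + ℓ' (nOf S len L)) ≤ (p.comp (2 * X + 2 + P')).eval L := by
      calc D.coinLen (2 * nOf S len L + 2 + ℓ' (nOf S len L)) ≤ p.eval (2 * nOf S len L + 2 + ℓ' (nOf S len L)) := hp _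
        _ ≤ p.eval (2 * L + 2 + P'.eval L) := polynomial_eval_mono p (by
            have := (hP' (nOf S len L)).trans (polynomial_eval_mono P' hnL); omega)
        _ = (p.comp (2 * X + 2 + P')).eval L := by simp [Polynomial.eval_comp]
    have h2 : q.eval (nOf S len L) + 1 ≤ (q + 1).eval L := by
      rw [eval_add, eval_one]; exact Nat.add_le_add_right (polynomial_eval_mono q hnL) 1
    have h3 : aStar (nOf S len L) ≤ q.eval L := (ha _).trans (polynomial_eval_mono q hnL)
    rw [eval_add, eval_mul]
    exact Nat.add_le_add (Nat.mul_le_mul h1 h2) h3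
  · simp only [advCl, if_neg hL]
    exact Nat.zero_le _

end AdvPost

open AdvPost

/-- Non-negligible nonnegative sequences are frequently above an inverse polynomial. [folklore] -/
private theorem exists_frequently_ge_of_not_negligible_adv {u : ℕ → ℝ} (h0 : ∀ n, 0 ≤ u n)
    (h : ¬ SuperpolynomialDecay atTop (fun n : ℕ => (n : ℝ)) u) :
    ∃ c : ℕ, ∃ᶠ n : ℕ in atTop, 1 / (n : ℝ) ^ c ≤ u n := by
  have h' := (isNegligible_iff_eventually_lt_of_nonneg h0).not.1 h
  push Not at h'
  obtain ⟨c, hc⟩ := h'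
  exact ⟨c, by simpa [Filter.not_eventually, not_lt] using hc⟩

/-- `|1ⁿ| = n`. [folklore] -/
private theorem length_unary' (n : ℕ) : (unaryEncodeNat n).length = n := unary_decode_encode_nat n

/-- **Computational indistinguishability is preserved by polynomial-time post-processing with a polynomially
bounded advice** (the tree's rendering of HILL's mildly non-uniform adversaries): for `X ≈_c Y` of level-wise
length `ℓ(n)` (polynomially bounded), `F ∈ FP`, and ANY advice sequence `a*(n) ≤ q(n)`,
`n ↦ F⟨1ⁿ, ⟨1^{a*(n)}, X_n⟩⟩ ≈_c n ↦ F⟨1ⁿ, ⟨1^{a*(n)}, Y_n⟩⟩`.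
[cite: HastadImpagliazzoLevinLuby1999, Def. 2.3.3 and §3.1 (mildly non-uniform adversary); Goldreich2001, §3.2.3 (digest, PDF p. 141)] -/
theorem IsCompIndistinguishable.map_fp_advice {X Y : Ensemble (List Bool)} {ℓ ℓ' : ℕ → ℕ}
    (h : IsCompIndistinguishable X Y) (hX : ∀ n, ∀ s ∈ (X n).support, s.length = ℓ n)
    (hY : ∀ n, ∀ s ∈ (Y n).support, s.length = ℓ n) (hℓ : ∃ P : Polynomial ℕ, ∀ n, ℓ n ≤ P.eval n)
    {F : List Bool → List Bool} (hF : F ∈ FP) (q : Polynomial ℕ) {aStar : ℕ → ℕ} (ha : ∀ n, aStar n ≤ q.eval n)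
    (hFlen : ∀ n (s : List Bool), s.length = ℓ n → (F (boolPair (unaryEncodeNat n) (boolPair (ones (aStar n)) s))).length = ℓ' n) :
    IsCompIndistinguishable (fun n => (X n).map fun s => F (boolPair (unaryEncodeNat n) (boolPair (ones (aStar n)) s)))
      (fun n => (Y n).map fun s => F (boolPair (unaryEncodeNat n) (boolPair (ones (aStar n)) s))) := by
  intro D hD
  by_contra hneg
  set adv : ℕ → ℝ := distAdvantage D (fun n => (X n).map fun s => F (boolPair (unaryEncodeNat n) (boolPair (ones (aStar n)) s)))
    (fun n => (Y n).map fun s => F (boolPair (unaryEncodeNat n) (boolPair (ones (aStar n)) s))) with hadv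
  obtain ⟨c, hc⟩ := exists_frequently_ge_of_not_negligible_adv (fun n => distAdvantage_nonneg D _ _ n) hneg
  set S : Set ℕ := {n | 1 / (n : ℝ) ^ c ≤ adv n} with hS
  have hSinf : S.Infinite := Nat.frequently_atTop_iff_infinite.1 hc
  set len : ℕ → ℕ := fun n => 2 * n + 2 + ℓ n with hlen_def
  have hlen : ∀ m, m ≤ len m := fun m => by simp only [hlen_def]; omega
  have hgood : (good S len).Infinite := good_infinite hSinf hlen
  obtain ⟨P, hP⟩ := hℓ
  -- `ℓ'` is polynomially bounded
  obtain ⟨P', hP'⟩ : ∃ P' : Polynomial ℕ, ∀ n, ℓ' n ≤ P'.eval n := by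
    obtain ⟨pF, M, hM⟩ := hF
    refine ⟨(Polynomial.X + Polynomial.C (TM2Comp.machinePushBound M.tm) * pF).comp (2 * Polynomial.X + 2 + (2 * q + 2 + P)), fun n => ?_⟩
    have h1 := (hM (boolPair (unaryEncodeNat n) (boolPair (ones (aStar n)) (List.replicate (ℓ n) false)))).length_le
    simp only [id] at h1
    rw [hFlen n _ (List.length_replicate ..), length_boolPair, length_unary', length_boolPair, List.length_replicate] at h1
    have h2 : 2 * n + 2 + (2 * (ones (aStar n)).length + 2 + ℓ n) ≤ 2 * n + 2 + (2 * q.eval n + 2 + P.eval n) := by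
      have := hP n; have := ha n; simp only [ones, List.length_replicate]; omega
    calc ℓ' n ≤ (Polynomial.X + Polynomial.C (TM2Comp.machinePushBound M.tm) * pF).eval (2 * n + 2 + (2 * (ones (aStar n)).length + 2 + ℓ n)) := by
          simpa using h1
      _ ≤ (Polynomial.X + Polynomial.C (TM2Comp.machinePushBound M.tm) * pF).eval (2 * n + 2 + (2 * q.eval n + 2 + P.eval n)) :=
          polynomial_eval_mono _ h2
      _ = _ := by simp [Polynomial.eval_comp]
  obtain ⟨p, hp⟩ := hD.2
  have hPPT : IsPPT (red F q D (advCl q D ℓ' aStar S len)) encodeBool :=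
    isPPT_red F q hD hF ⟨_, advCl_le q D S hlen hp hP' ha⟩
  have hdec := h (red F q D (advCl q D ℓ' aStar S len)) hPPT
  have hagree : ∀ n ∈ good S len, distAdvantage (red F q D (advCl q D ℓ' aStar S len)) X Y n = adv n := by
    intro n hn
    have hcln : advCl q D ℓ' aStar S len (2 * n + 2 + ℓ n) = D.coinLen (2 * n + 2 + ℓ' n) * (q.eval n + 1) + aStar n :=
      advCl_len_of_mem_good q D ℓ' aStar hn
    simp only [hadv, distAdvantage]
    rw [acceptPMF_red F q D (X n) (hX n) (ha n) (fun s hs => hFlen n s (hX n s hs)) hcln,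
      acceptPMF_red F q D (Y n) (hY n) (ha n) (fun s hs => hFlen n s (hY n s hs)) hcln]
  have hev : ∀ᶠ n in atTop, distAdvantage (red F q D (advCl q D ℓ' aStar S len)) X Y n < 1 / (n : ℝ) ^ c :=
    (isNegligible_iff_eventually_lt_of_nonneg fun n => distAdvantage_nonneg _ _ _ n).1 hdec c
  have hfr : ∃ᶠ n in atTop, n ∈ good S len := Nat.frequently_atTop_iff_infinite.2 hgood
  obtain ⟨n, hnS', hlt⟩ := (hfr.and_eventually hev).exists
  have h1 : 1 / (n : ℝ) ^ c ≤ adv n := hnS'.1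
  rw [← hagree n hnS'] at h1
  exact absurd hlt (not_lt.2 h1)


end Literature.Computability.Cryptography
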